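import Summits.CriticalPhenomena.PercolationContinuityZ3.Theorems.PercNearOneGluingNoHeavyLowerTailSahiTransportTrace
import Summits.CriticalPhenomena.PercolationContinuityZ3.Theorems.PercNearOneGluingNoHeavyLowerTailSahiTransportLast
import Summits.CriticalPhenomena.PercolationContinuityZ3.Theorems.PercNearOneGluingNoHeavyLowerTailSahiCombPrincipalMeet

/-!
# `NoHeavyLowerTail` (crux stmt-CriticalPhenomena-4575), Sahi / Kahn positivity: ALL BLOCKS BUT ONE (IV) — the block events and their probabilities

Support file (cell `prim-l12`, seat P3, gen 8; `--supports stmt-CriticalPhenomena-4575`).  No `sorry`, no named facts, standard axioms.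
New mathematics (this programme).

SETTING.  A block assignment `β : Fin k → Fin m` partitions the pattern cube's coordinates into blocks `blk β i = {x : β x = i}`;
`cylB β i = {U : blk β i ⊆ U}` is "block `i` open", `aboH β = {U : at most one block is not open}` (the first slot
`Th_{m−1}(∧_{B_1}, …, ∧_{B_m})`), `exoneB β = aboH β ∖ {⊤}` ("exactly one block not open") and `rhoB q β = μ(· | exoneB β)` is the certificate.
THIS FILE (probability bookkeeping for `…SahiBlocksAllButOne`):
* `hat_aboH`: the TRACE-MAXIMAL family of an up-set `𝒳` (`…SahiTransportTrace.hat`) is the intersection over the blocks of its sections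
  `sec β i 𝒳 = {ω : ω ∪ (blk β i)ᶜ ∈ 𝒳}` ("all other blocks open"), each determined by its own block;
* independence over the blocks (`Literature…prodBernoulli_real_inter_biInter_of_determinedBy`): `μ(⋂_i sec_i) = ∏_i μ(sec_i)` (`pr_iInter_sec`),
  `μ(⊤) = ∏_i P_i` with `P_i = μ(cylB β i)`, and the decomposition of `aboH β` by the non-open block (`ind_aboH_eq`) giving
  `μ(aboH ∩ ⋂_i sec_i) = μ(⊤) + Σ_i (μ(sec_i) − P_i)·∏_{j≠i} P_j` (`pr_aboH_inter_iInter_sec`). [this work]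
-/

noncomputable section

open scoped Classical

namespace Summit.CriticalPhenomena.PercolationContinuityZ3.Theorems

namespace SahiBlocksAllButOne

open Finset
open SahiHittingSlot SahiTransportCert SahiCombPrincipalMeet
open Literature.Combinatorics.Sahi2008
open Literature.Probability.LatticeModels (prodBernoulli prodBernoulli_real_inter_biInter_of_determinedBy)
open Literature.Probability.Percolation (DeterminedBy determinedBy_iff determinedBy_univ)
open Literature.Probability.Percolation.BHK2006 (ind_inter)
open Literature.Probability.Percolation.DecisionTree (ind ind_of_mem ind_of_not_mem ind_nonneg)

variable {k m : ℕ} (q : Fin k → unitInterval) (β : Fin k → Fin m)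

/-! ### Blocks and the block events -/

/-- The `i`-th block of coordinates. [this work] -/
def blk (i : Fin m) : Set (Fin k) := {x | β x = i}

/-- "Block `i` open". [this work] -/
def cylB (i : Fin m) : Set (Set (Fin k)) := {U | blk β i ⊆ U}

/-- The ALL-BLOCKS-BUT-ONE event: at most one block is not open. [this work] -/
def aboH : Set (Set (Fin k)) := {U | ∀ i j, ¬ (blk β i ⊆ U) → ¬ (blk β j ⊆ U) → i = j}

/-- "Exactly one block not open": the event without the top pattern. [this work] -/
def exoneB : Set (Set (Fin k)) := {Set.univ}ᶜ ∩ aboH β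

/-- **The certificate**: `ρ = μ(· | exactly one block not open)`. [this work] -/
def rhoB (T : Set (Fin k)) : ℝ := bernoulliWeight q T * ind (exoneB β) T / pr q (exoneB β)

/-- The section of a family at "all blocks other than `i` open". [this work] -/
def sec (i : Fin m) (𝒳 : Set (Set (Fin k))) : Set (Set (Fin k)) := secUnion (blk β i)ᶜ 𝒳

/-- "Block `i` is the only block that is not open". [this work] -/
def onlyB (i : Fin m) : Set (Set (Fin k)) := (cylB β i)ᶜ ∩ ⋂ j ∈ univ.erase i, cylB β j

variable {β}

/-- Distinct blocks are disjoint: a point of block `j ≠ i` lies outside block `i`. [this work] -/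
theorem blk_subset_compl {i j : Fin m} (h : j ≠ i) : blk β j ⊆ (blk β i)ᶜ := fun _ hx hxi => h (hx.symm.trans hxi)

/-- All blocks open means the top pattern. [this work] -/
theorem eq_univ_of_forall_blk {U : Set (Fin k)} (h : ∀ i, blk β i ⊆ U) : U = Set.univ :=
  Set.eq_univ_of_forall fun x => h (β x) rfl

/-- `ω ∪ (blk i)ᶜ` contains every other block. [this work] -/
theorem blk_subset_union_compl (ω : Set (Fin k)) {i j : Fin m} (h : j ≠ i) : blk β j ⊆ ω ∪ (blk β i)ᶜ :=
  fun _ hx => Or.inr (blk_subset_compl h hx)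

variable (β)

/-- Block cylinders are increasing. [this work] -/
theorem isUpperSet_cylB (i : Fin m) : IsUpperSet (cylB β i) := fun _ _ hle hU => Set.Subset.trans hU hle

/-- The all-blocks-but-one event is increasing. [this work] -/
theorem isUpperSet_aboH : IsUpperSet (aboH β) :=
  fun _ _ hle hU i j hi hj => hU i j (fun h => hi (Set.Subset.trans h hle)) (fun h => hj (Set.Subset.trans h hle))

/-- The top pattern lies in the event. [this work] -/
theorem univ_mem_aboH : (Set.univ : Set (Fin k)) ∈ aboH β := fun _ _ hi _ => (hi (Set.subset_univ _)).elim

/-- A pattern with all blocks but `i` open lies in the event. [this work] -/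
theorem mem_aboH_of_others {U : Set (Fin k)} (i : Fin m) (h : ∀ j, j ≠ i → blk β j ⊆ U) : U ∈ aboH β := by
  intro j l hj hl
  have hj' : j = i := by by_contra hne; exact hj (h j hne)
  have hl' : l = i := by by_contra hne; exact hl (h l hne)
  rw [hj', hl']

/-- `ω ∪ (blk i)ᶜ` lies in the event. [this work] -/
theorem union_compl_mem_aboH (ω : Set (Fin k)) (i : Fin m) : ω ∪ (blk β i)ᶜ ∈ aboH β :=
  mem_aboH_of_others β i fun _ hj => blk_subset_union_compl ω hj

/-! ### Trace-maximal families are intersections of sections -/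

/-- Membership in a section. [this work] -/
theorem mem_sec {i : Fin m} {𝒳 : Set (Set (Fin k))} {ω : Set (Fin k)} : ω ∈ sec β i 𝒳 ↔ ω ∪ (blk β i)ᶜ ∈ 𝒳 := Iff.rfl

/-- Sections are increasing. [this work] -/
theorem isUpperSet_sec (i : Fin m) {𝒳 : Set (Set (Fin k))} (h𝒳 : IsUpperSet 𝒳) : IsUpperSet (sec β i 𝒳) :=
  isUpperSet_secUnion _ h𝒳

/-- A section is determined by its own block. [this work] -/
theorem determinedBy_sec (i : Fin m) (𝒳 : Set (Set (Fin k))) : DeterminedBy (sec β i 𝒳) (blk β i) := by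
  have h := determinedBy_secUnion (blk β i)ᶜ 𝒳
  rwa [compl_compl] at h

/-- The block cylinder lies in the corresponding section of a family containing the top pattern. [this work] -/
theorem cylB_subset_sec (i : Fin m) {𝒳 : Set (Set (Fin k))} (huniv : Set.univ ∈ 𝒳) : cylB β i ⊆ sec β i 𝒳 := by
  intro U hU
  rw [mem_sec, show U ∪ (blk β i)ᶜ = Set.univ from Set.eq_univ_of_forall fun x => by
    by_cases hx : x ∈ blk β i; exacts [Or.inl (hU hx), Or.inr hx]]
  exact huniv

/-- Sections of an intersection. [this work] -/
theorem sec_inter (i : Fin m) (𝒳 𝒵 : Set (Set (Fin k))) : sec β i (𝒳 ∩ 𝒵) = sec β i 𝒳 ∩ sec β i 𝒵 := rfl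

/-- **The trace-maximal family of an up-set is the intersection of its sections** (nonempty block structure). [this work] -/
theorem hat_aboH (hm : 0 < m) {𝒳 : Set (Set (Fin k))} (h𝒳 : IsUpperSet 𝒳) :
    hat (aboH β) 𝒳 = ⋂ i ∈ (univ : Finset (Fin m)), sec β i 𝒳 := by
  ext ω
  simp only [hat, Set.mem_setOf_eq, Set.mem_iInter, mem_sec]
  constructor
  · intro h i _
    exact h _ Set.subset_union_left (union_compl_mem_aboH β ω i)
  · intro h T hωT hT
    by_cases hall : ∀ i, blk β i ⊆ T
    · rw [eq_univ_of_forall_blk hall]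
      exact h𝒳 (Set.subset_univ _) (h ⟨0, hm⟩ (mem_univ _))
    · push Not at hall
      obtain ⟨i, hi⟩ := hall
      have hothers : ∀ j, j ≠ i → blk β j ⊆ T := fun j hj => by by_contra hjT; exact hj (hT j i hjT hi)
      refine h𝒳 (Set.union_subset hωT fun x hx => ?_) (h i (mem_univ i))
      exact hothers (β x) (fun h' => hx (h' ▸ rfl)) rfl

/-- The trace-maximal family of the empty family is empty. [this work] -/
theorem hat_aboH_empty : hat (aboH β) (∅ : Set (Set (Fin k))) = ∅ :=
  Set.eq_empty_of_forall_notMem fun ω h => h Set.univ (Set.subset_univ ω) (univ_mem_aboH β)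

/-! ### The decomposition of the event by the non-open block -/

/-- The only-block events are pairwise disjoint and disjoint from the top pattern; together they partition `aboH β`:
the indicator identity. [this work] -/
theorem ind_aboH_eq (U : Set (Fin k)) :
    ind (aboH β) U = ind ({Set.univ} : Set (Set (Fin k))) U + ∑ i, ind (onlyB β i) U := by
  by_cases hall : ∀ i, blk β i ⊆ U
  · have hU := eq_univ_of_forall_blk hall
    rw [ind_of_mem (hU ▸ univ_mem_aboH β), ind_of_mem (Set.mem_singleton_iff.2 hU),
      sum_eq_zero fun i _ => ind_of_not_mem fun h => h.1 (hall i), add_zero]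
  · push Not at hall
    obtain ⟨i, hi⟩ := hall
    have hne : U ≠ Set.univ := fun h => hi (h ▸ Set.subset_univ _)
    rw [ind_of_not_mem (fun h => hne (Set.mem_singleton_iff.1 h)), zero_add]
    by_cases hU : U ∈ aboH β
    · rw [ind_of_mem hU]
      have hothers : ∀ j, j ≠ i → blk β j ⊆ U := fun j hj => by by_contra hjU; exact hj (hU j i hjU hi)
      rw [sum_eq_single i (fun j _ hji => ind_of_not_mem fun h => h.1 (hothers j hji)) (fun h => (h (mem_univ i)).elim)]
      have hmem : U ∈ onlyB β i := by
        refine ⟨hi, ?_⟩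
        simp only [Set.mem_iInter]
        exact fun j hj => hothers j (ne_of_mem_erase hj)
      exact (ind_of_mem hmem).symm
    · rw [ind_of_not_mem hU]
      refine (sum_eq_zero fun j _ => ind_of_not_mem fun h => hU (mem_aboH_of_others β j fun l hl => ?_)).symm
      have := h.2
      simp only [Set.mem_iInter] at this
      exact this l (mem_erase.2 ⟨hl, mem_univ l⟩)

/-- `μ(aboH ∩ 𝒴) = μ({⊤} ∩ 𝒴) + Σ_i μ(onlyB i ∩ 𝒴)`. [this work] -/
theorem pr_aboH_inter (𝒴 : Set (Set (Fin k))) :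
    pr q (aboH β ∩ 𝒴) = pr q (({Set.univ} : Set (Set (Fin k))) ∩ 𝒴) + ∑ i, pr q (onlyB β i ∩ 𝒴) := by
  simp only [pr_eq_sum, ind_inter, ind_aboH_eq]
  rw [sum_comm, ← sum_add_distrib]
  refine sum_congr rfl fun T _ => ?_
  rw [add_mul, mul_add, sum_mul, mul_sum]

/-! ### Independence over the blocks -/

/-- The blocks as finsets (fibres of `β`). [this work] -/
theorem coe_fibre (i : Fin m) : (↑(univ.filter fun x : Fin k => β x = i) : Set (Fin k)) = blk β i := by
  ext x; simp [blk]

/-- The fibres are pairwise disjoint. [this work] -/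
theorem pairwiseDisjoint_fibre (s : Finset (Fin m)) : (↑s : Set (Fin m)).PairwiseDisjoint fun i => univ.filter fun x : Fin k => β x = i := by
  intro i _ j _ hij
  exact Finset.disjoint_filter.2 fun x _ hi hj => hij (hi.symm.trans hj)

/-- **Iterated independence**: an event determined by the complement of the blocks in `s` is independent of block events over `s`.
[this work] -/
theorem pr_inter_biInter (s : Finset (Fin m)) {C : Fin m → Set (Set (Fin k))} (hC : ∀ i ∈ s, DeterminedBy (C i) (blk β i))
    {A : Set (Set (Fin k))} (hA : DeterminedBy A (⋃ i ∈ s, blk β i)ᶜ) :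
    pr q (A ∩ ⋂ i ∈ s, C i) = pr q A * ∏ i ∈ s, pr q (C i) := by
  have h := prodBernoulli_real_inter_biInter_of_determinedBy q s (fun i => univ.filter fun x : Fin k => β x = i)
    (pairwiseDisjoint_fibre β s) (C := C) (fun i hi => by rw [coe_fibre]; exact hC i hi) (fun i _ => MeasurableSet.of_discrete)
    (A := A) (by simpa only [coe_fibre] using hA) MeasurableSet.of_discrete
  simpa only [pr, ex_bernoulliWeight_ind] using h

/-- `μ(⋂_i sec_i 𝒳) = ∏_i μ(sec_i 𝒳)`. [this work] -/
theorem pr_iInter_sec (𝒳 : Set (Set (Fin k))) :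
    pr q (⋂ i ∈ (univ : Finset (Fin m)), sec β i 𝒳) = ∏ i, pr q (sec β i 𝒳) := by
  have h := pr_inter_biInter q β univ (C := fun i => sec β i 𝒳) (fun i _ => determinedBy_sec β i 𝒳) (A := Set.univ)
    (determinedBy_univ _)
  rwa [Set.univ_inter, pr_univ, one_mul] at h

/-- `⋂_i cylB i = {⊤}`. [this work] -/
theorem iInter_cylB : (⋂ i ∈ (univ : Finset (Fin m)), cylB β i) = ({Set.univ} : Set (Set (Fin k))) := by
  ext U
  simp only [Set.mem_iInter, Set.mem_singleton_iff]
  exact ⟨fun h => eq_univ_of_forall_blk fun i => h i (mem_univ i), fun h i _ => h ▸ Set.subset_univ _⟩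

/-- `μ(⊤) = ∏_i P_i`. [this work] -/
theorem pr_top_eq : pr q ({Set.univ} : Set (Set (Fin k))) = ∏ i, pr q (cylB β i) := by
  have h := pr_inter_biInter q β univ (C := cylB β) (fun i _ => determinedBy_cylinder (blk β i)) (A := Set.univ) (determinedBy_univ _)
  rwa [Set.univ_inter, pr_univ, one_mul, iInter_cylB] at h

/-- `μ(onlyB i ∩ ⋂_l sec_l) = (μ(sec_i) − P_i)·∏_{j ≠ i} P_j` for a family containing the top pattern. [this work] -/
theorem pr_onlyB_inter_iInter_sec (i : Fin m) {𝒳 : Set (Set (Fin k))} (huniv : Set.univ ∈ 𝒳) :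
    pr q (onlyB β i ∩ ⋂ l ∈ (univ : Finset (Fin m)), sec β l 𝒳) =
      (pr q (sec β i 𝒳) - pr q (cylB β i)) * ∏ j ∈ univ.erase i, pr q (cylB β j) := by
  -- the event is `(sec_i ∖ cylB i) ∩ ⋂_{j ≠ i} cylB j`
  have hset : onlyB β i ∩ (⋂ l ∈ (univ : Finset (Fin m)), sec β l 𝒳) = ((cylB β i)ᶜ ∩ sec β i 𝒳) ∩ ⋂ j ∈ univ.erase i, cylB β j := by
    ext U
    simp only [onlyB, Set.mem_inter_iff, Set.mem_iInter, Set.mem_compl_iff]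
    constructor
    · rintro ⟨⟨hni, hoth⟩, hsec⟩; exact ⟨⟨hni, hsec i (mem_univ i)⟩, hoth⟩
    · rintro ⟨⟨hni, hsec⟩, hoth⟩
      refine ⟨⟨hni, hoth⟩, fun l _ => ?_⟩
      by_cases hl : l = i
      · rw [hl]; exact hsec
      · exact cylB_subset_sec β l huniv (hoth l (mem_erase.2 ⟨hl, mem_univ l⟩))
  have hdet : DeterminedBy ((cylB β i)ᶜ ∩ sec β i 𝒳) (⋃ j ∈ univ.erase i, blk β j)ᶜ := by
    have h1 : DeterminedBy ((cylB β i)ᶜ ∩ sec β i 𝒳) (blk β i) := by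
      have hc : DeterminedBy (cylB β i)ᶜ (blk β i) := by
        have h := determinedBy_cylinder (blk β i)
        rw [determinedBy_iff] at h ⊢
        intro ω ω' hω
        rw [Set.mem_compl_iff, Set.mem_compl_iff]
        exact not_congr (h ω ω' hω)
      exact hc.inter (determinedBy_sec β i 𝒳)
    refine h1.mono fun x hx => ?_
    simp only [Set.mem_compl_iff, Set.mem_iUnion, not_exists]
    intro j hj hxj
    exact (ne_of_mem_erase hj) (hxj.symm.trans hx)
  rw [hset, pr_inter_biInter q β (univ.erase i) (C := cylB β) (fun j _ => determinedBy_cylinder (blk β j)) hdet, pr_compl_inter,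
    Set.inter_eq_left.2 (cylB_subset_sec β i huniv)]

/-- **`μ(aboH ∩ ⋂_i sec_i) = μ(⊤) + Σ_i (μ(sec_i) − P_i)·∏_{j≠i} P_j`** for a family containing the top pattern. [this work] -/
theorem pr_aboH_inter_iInter_sec {𝒳 : Set (Set (Fin k))} (huniv : Set.univ ∈ 𝒳) :
    pr q (aboH β ∩ ⋂ l ∈ (univ : Finset (Fin m)), sec β l 𝒳) =
      pr q ({Set.univ} : Set (Set (Fin k))) + ∑ i, (pr q (sec β i 𝒳) - pr q (cylB β i)) * ∏ j ∈ univ.erase i, pr q (cylB β j) := by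
  have htop : ({Set.univ} : Set (Set (Fin k))) ∩ (⋂ l ∈ (univ : Finset (Fin m)), sec β l 𝒳) = {Set.univ} := by
    refine Set.inter_eq_left.2 (Set.singleton_subset_iff.2 ?_)
    simp only [Set.mem_iInter]
    exact fun l _ => cylB_subset_sec β l huniv (Set.subset_univ _)
  rw [pr_aboH_inter, htop]
  exact congrArg _ (sum_congr rfl fun i _ => pr_onlyB_inter_iInter_sec q β i huniv)

/-- Sums against `ρ`: `Σ_T ρ(T) 1_𝒲(T) = μ(exoneB ∩ 𝒲)/μ(exoneB)`. [this work] -/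
theorem sum_rhoB_ind (𝒲 : Set (Set (Fin k))) : ∑ T, rhoB q β T * ind 𝒲 T = pr q (exoneB β ∩ 𝒲) / pr q (exoneB β) := by
  rw [pr_eq_sum q (exoneB β ∩ 𝒲), Finset.sum_div]
  refine sum_congr rfl fun T _ => ?_
  rw [rhoB, ind_inter]; ring

/-- `μ(exoneB ∩ 𝒴) = μ(aboH ∩ 𝒴) − μ(⊤)` when `⊤ ∈ 𝒴`. [this work] -/
theorem pr_exoneB_inter {𝒴 : Set (Set (Fin k))} (huniv : Set.univ ∈ 𝒴) :
    pr q (exoneB β ∩ 𝒴) = pr q (aboH β ∩ 𝒴) - pr q ({Set.univ} : Set (Set (Fin k))) := by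
  rw [exoneB, Set.inter_assoc, pr_compl_inter,
    Set.inter_eq_left.2 (Set.singleton_subset_iff.2 (show (Set.univ : Set (Fin k)) ∈ aboH β ∩ 𝒴 from ⟨univ_mem_aboH β, huniv⟩))]

/-- The top pattern lies in every intersection of sections of a family containing it. [this work] -/
theorem univ_mem_iInter_sec {𝒳 : Set (Set (Fin k))} (huniv : Set.univ ∈ 𝒳) :
    (Set.univ : Set (Fin k)) ∈ ⋂ l ∈ (univ : Finset (Fin m)), sec β l 𝒳 := by
  simp only [Set.mem_iInter]
  exact fun l _ => cylB_subset_sec β l huniv (Set.subset_univ _)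

/-- The probability of a block cylinder is the product of its parameters. [folklore] -/
theorem pr_cylB_eq (i : Fin m) : pr q (cylB β i) = ∏ x ∈ univ.filter (fun x => β x = i), (q x : ℝ) := by
  have h := Literature.Probability.LatticeModels.prodBernoulli_real_subset q (univ.filter fun x => β x = i)
  rw [coe_fibre] at h
  rw [← h, pr, ex_bernoulliWeight_ind]; rfl

end SahiBlocksAllButOne

end Summit.CriticalPhenomena.PercolationContinuityZ3.Theorems
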